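import Mathlib
import Literature.NumberTheory.Automorphic.MeyerThetaMellin
import Literature.NumberTheory.LFunctions.ZetaRealAxis
import HarnessLib

/-!
# THETA–MELLIN VANISHING: the Mellin transform of `Θ_G = Σ_{n ≥ 1} G(n·)` vanishes at the zeros of `ζ` (RH-FREE)

WEIL column (LADDER-RH, rung W-P(P2), cell `rh-explicit`; director's ruling 2026-08-25T22:44Z: crux `ThetaCertificateSound` behind
`UCRange157To60000`). This file is the analytic-continuation core «(Z1)» of a KERNEL version of handoff-idea-2's PART XIX B-spline
THETA certificate (cc-s2-6 THETA-CERT-cc6 §D; cc-s2-3 WEIL-THEORY-R3 §3′): for a Lipschitz profile `G` supported in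
`[c₁, c₂] ⊂ (0, ∞)` with `∫ G = 0`,
* `mellin_thetaSum_eq_zeta_mul` — Riemann's unfolding `mellin Θ_G s = ζ(s) · mellin G s` for `1 < Re s`, for ANY profile whose
  Mellin integral converges on `Re s > 0` (the tree's `MeyerThetaMellin.mellin_tsum_comp_nat_mul` is the Schwartz case);
* `mellin_thetaSum_eq_zeta_mul_of_mem_slit` — its ANALYTIC CONTINUATION to the slit half-plane `{Re s > 0} ∖ (0, 1]` (identity
  theorem on a star-convex open set; `mellin Θ_G` is holomorphic on `Re s > 0` because `Θ_G` is bounded near `0`);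
* `ProfileHyp.norm_thetaSum_le` — the Riemann-sum cancellation `‖Θ_G(t)‖ ≤ L (c₂ + t)` on `(0, c₁)` from `∫ G = 0`;
* **`ProfileHyp.mellin_thetaSum_vanishes_at_zeta_zeros`** — hence `mellin Θ_G ρ = 0` at every nontrivial zero `ρ`
  (`0 < Re ρ < 1`; zeros are off the real axis by `riemannZeta_ofReal_ne_zero_of_pos_of_lt_one`).
Use: with `G = h(·/λ)` and the PART XIX witness `g = G₀ χ`, `G₀(x) = e^{x/2} Θ_G(eˣ)`, this gives `ĝ⁻(ρ) = −T̂⁻(ρ)` at every zero,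
so the tree's `re_weilQuadratic_le_of_zeroSum_le` bounds `Q_F(g⁻)` by the zero sum of the cut tail `T = G₀(1 − χ)` alone — no
explicit formula for non-compactly-supported functions is needed. UPPER-clause technology only; nothing here bears on the truth of RH.
References: B. Riemann (1859) (the unfolding); R. Meyer, Duke Math. J. 127 (2005) §5.7 (`Meyer2005`, as in `MeyerThetaMellin`).
-/

set_option linter.dupNamespace false

noncomputable section

open MeasureTheory Set Filter Asymptotics Complex
open scoped Topology

namespace Summit.RiemannHypothesis.RiemannHypothesis.Theorems.WeilColumn.ThetaMellin

/-- The theta series of a profile: `Θ_G(t) = Σ_{n ≥ 1} G(n t)`. -/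
def thetaSum (G : ℝ → ℂ) (t : ℝ) : ℂ := ∑' n : ℕ, G (((n + 1 : ℕ) : ℝ) * t)

/-- **Riemann's unfolding, `HasSum` form, for a general profile** whose Mellin integral converges on `Re s > 0`:
for `1 < Re s`, `mellin Θ_G s = Σ_{n≥1} n^{-s} · mellin G s`. [folklore; cf. Meyer2005 §5.7] -/
theorem hasSum_mellin_thetaSum {G : ℝ → ℂ} (hG : ∀ ⦃z : ℂ⦄, 0 < z.re → MellinConvergent G z) {s : ℂ}
    (hs : 1 < s.re) :
    HasSum (fun n : ℕ => (((n + 1 : ℕ) : ℝ) : ℂ) ^ (-s) * mellin G s) (mellin (thetaSum G) s) := by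
  set F : ℕ → ℝ → ℂ := fun n t => (t : ℂ) ^ (s - 1) • G (((n + 1 : ℕ) : ℝ) * t) with hF
  have hpos : ∀ n : ℕ, (0 : ℝ) < ((n + 1 : ℕ) : ℝ) := fun n => by positivity
  have hint : ∀ n : ℕ, Integrable (F n) (volume.restrict (Ioi (0 : ℝ))) := fun n =>
    (MellinConvergent.comp_mul_left (f := G) (s := s) (hpos n)).mpr (hG (by linarith))
  set I : ℝ := ∫ t in Ioi (0 : ℝ), t ^ (s.re - 1) * ‖G t‖ with hI
  have hnorm : ∀ n : ℕ, ∫ t in Ioi (0 : ℝ), ‖F n t‖ = (((n + 1 : ℕ) : ℝ) ^ s.re)⁻¹ * I := by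
    intro n
    rw [hF]
    simp only
    rw [Literature.NumberTheory.Automorphic.Meyer.integral_norm_mellin_integrand_comp_mul G s (hpos n),
      Real.rpow_neg (hpos n).le]
  have hsum : Summable fun n : ℕ => ∫ t in Ioi (0 : ℝ), ‖F n t‖ := by
    have h1 : Summable fun n : ℕ => (((n : ℝ) ^ s.re)⁻¹ : ℝ) := Real.summable_nat_rpow_inv.mpr hs
    have h2 : Summable fun n : ℕ => ((((n + 1 : ℕ) : ℝ) ^ s.re)⁻¹ : ℝ) :=
      (summable_nat_add_iff 1).mpr h1
    exact (h2.mul_right I).congr fun n => (hnorm n).symm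
  have H := hasSum_integral_of_summable_integral_norm hint hsum
  have hterm : ∀ n : ℕ, ∫ t in Ioi (0 : ℝ), F n t =
      (((n + 1 : ℕ) : ℝ) : ℂ) ^ (-s) * mellin G s := by
    intro n
    have h := mellin_comp_mul_left G s (hpos n)
    rw [mellin] at h
    rw [hF]
    simp only
    rw [h, smul_eq_mul]
  have htot : (∫ t in Ioi (0 : ℝ), ∑' n : ℕ, F n t) = mellin (thetaSum G) s := by
    rw [mellin]
    refine setIntegral_congr_fun measurableSet_Ioi fun t _ => ?_
    rw [hF, thetaSum]
    simp only [smul_eq_mul]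
    exact tsum_mul_left
  simp_rw [hterm] at H
  rw [htot] at H
  exact H

/-- **Riemann's unfolding** for a general profile: `1 < Re s ⇒ mellin Θ_G s = ζ(s) · mellin G s`. [folklore; cf. Meyer2005 §5.7] -/
theorem mellin_thetaSum_eq_zeta_mul {G : ℝ → ℂ} (hG : ∀ ⦃z : ℂ⦄, 0 < z.re → MellinConvergent G z) {s : ℂ}
    (hs : 1 < s.re) : mellin (thetaSum G) s = riemannZeta s * mellin G s := by
  rw [← (hasSum_mellin_thetaSum hG hs).tsum_eq, tsum_mul_right, zeta_eq_tsum_one_div_nat_add_one_cpow hs]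
  congr 1
  refine tsum_congr fun n => ?_
  rw [one_div, ← Complex.cpow_neg]
  norm_cast

/-- The slit half-plane `{Re s > 0} \ (0, 1]` on which the unfolding continues (it avoids only the pole `s = 1` and the real
segment below it, where no zero of `ζ` lies). -/
def slitHalfPlane : Set ℂ := {s : ℂ | 0 < s.re ∧ (s.im ≠ 0 ∨ 1 < s.re)}

/-- The slit half-plane is open. [folklore] -/
theorem isOpen_slitHalfPlane : IsOpen slitHalfPlane := by
  have h1 : IsOpen {s : ℂ | 0 < s.re} := isOpen_lt continuous_const Complex.continuous_re
  have h2 : IsOpen {s : ℂ | s.im ≠ 0} := isOpen_ne_fun Complex.continuous_im continuous_const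
  have h3 : IsOpen {s : ℂ | 1 < s.re} := isOpen_lt continuous_const Complex.continuous_re
  simpa [slitHalfPlane, setOf_and, setOf_or] using h1.inter (h2.union h3)

/-- `2` lies in the slit half-plane (the base point of the identity theorem). [folklore] -/
theorem two_mem_slitHalfPlane : (2 : ℂ) ∈ slitHalfPlane := by
  refine ⟨by norm_num, Or.inr (by norm_num)⟩

/-- The slit half-plane is star-convex about `2`, hence preconnected. -/
theorem starConvex_slitHalfPlane : StarConvex ℝ (2 : ℂ) slitHalfPlane := by
  intro x hx a b ha hb hab
  obtain ⟨hxre, hx'⟩ := hx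
  have hre : (a • (2 : ℂ) + b • x).re = a * 2 + b * x.re := by simp
  have him : (a • (2 : ℂ) + b • x).im = b * x.im := by simp
  refine ⟨?_, ?_⟩
  · rw [hre]
    rcases hb.eq_or_lt with rfl | hb'
    · have : a = 1 := by linarith
      subst this; norm_num
    · nlinarith
  · rw [him, hre]
    rcases hb.eq_or_lt with rfl | hb'
    · have : a = 1 := by linarith
      subst this; right; norm_num
    · rcases hx' with hxi | hxr
      · left; exact mul_ne_zero hb'.ne' hxi
      · right
        have : a = 1 - b := by linarith
        subst this
        nlinarith

/-- The slit half-plane is preconnected (star-convex about `2`). [folklore] -/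
theorem isPreconnected_slitHalfPlane : IsPreconnected slitHalfPlane :=
  (starConvex_slitHalfPlane.isPathConnected two_mem_slitHalfPlane).isConnected.isPreconnected

/-- Every nontrivial zero of `ζ` (`0 < Re ρ < 1`) lies in the slit half-plane: it is off the real axis. -/
theorem mem_slitHalfPlane_of_zeta_zero {ρ : ℂ} (hζ : riemannZeta ρ = 0) (h0 : 0 < ρ.re) (h1 : ρ.re < 1) :
    ρ ∈ slitHalfPlane := by
  refine ⟨h0, Or.inl fun him => ?_⟩
  have hρ : ρ = ((ρ.re : ℝ) : ℂ) := by
    apply Complex.ext <;> simp [him]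
  rw [hρ] at hζ
  exact Literature.NumberTheory.LFunctions.riemannZeta_ofReal_ne_zero_of_pos_of_lt_one ρ.re h0 h1 hζ

/-- **ANALYTIC CONTINUATION OF THE UNFOLDING.** If `mellin G` and `mellin Θ_G` are holomorphic on `Re s > 0` and `mellin G`
converges there, then `mellin Θ_G s = ζ(s) · mellin G s` on the whole slit half-plane. [folklore: identity theorem] -/
theorem mellin_thetaSum_eq_zeta_mul_of_mem_slit {G : ℝ → ℂ}
    (hG : ∀ ⦃z : ℂ⦄, 0 < z.re → MellinConvergent G z)
    (hGd : ∀ ⦃z : ℂ⦄, 0 < z.re → DifferentiableAt ℂ (mellin G) z)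
    (hΘd : ∀ ⦃z : ℂ⦄, 0 < z.re → DifferentiableAt ℂ (mellin (thetaSum G)) z)
    {s : ℂ} (hs : s ∈ slitHalfPlane) :
    mellin (thetaSum G) s = riemannZeta s * mellin G s := by
  have hU := isOpen_slitHalfPlane
  have hf : AnalyticOnNhd ℂ (mellin (thetaSum G)) slitHalfPlane :=
    DifferentiableOn.analyticOnNhd (fun z hz => (hΘd hz.1).differentiableWithinAt) hU
  have hg : AnalyticOnNhd ℂ (fun z => riemannZeta z * mellin G z) slitHalfPlane := by
    refine DifferentiableOn.analyticOnNhd (fun z hz => ?_) hU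
    have hz1 : z ≠ 1 := by
      rintro rfl
      rcases hz.2 with h | h <;> norm_num at h
    exact ((differentiableAt_riemannZeta hz1).mul (hGd hz.1)).differentiableWithinAt
  have hev : mellin (thetaSum G) =ᶠ[𝓝 (2 : ℂ)] fun z => riemannZeta z * mellin G z := by
    have hopen : IsOpen {z : ℂ | 1 < z.re} := isOpen_lt continuous_const Complex.continuous_re
    filter_upwards [hopen.mem_nhds (by norm_num : (1 : ℝ) < (2 : ℂ).re)] with z hz
    exact mellin_thetaSum_eq_zeta_mul hG hz
  exact hf.eqOn_of_preconnected_of_eventuallyEq hg isPreconnected_slitHalfPlane two_mem_slitHalfPlane hev hs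

/-- **THETA–MELLIN VANISHING AT THE ZEROS (continuation core).** Under the same hypotheses, `mellin Θ_G ρ = 0` at every nontrivial
zero `ρ` of `ζ`. The remaining analytic inputs for the PART XIX witness (`G = h(·/λ)` with `∫ h = 0`: convergence of `mellin G` on
`Re > 0`, boundedness of `Θ_G` near `0`, compact support) are discharged separately. [this seat, R3 §3′ (Z1)] -/
theorem mellin_thetaSum_eq_zero_of_zeta_zero {G : ℝ → ℂ}
    (hG : ∀ ⦃z : ℂ⦄, 0 < z.re → MellinConvergent G z)
    (hGd : ∀ ⦃z : ℂ⦄, 0 < z.re → DifferentiableAt ℂ (mellin G) z)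
    (hΘd : ∀ ⦃z : ℂ⦄, 0 < z.re → DifferentiableAt ℂ (mellin (thetaSum G)) z)
    {ρ : ℂ} (hζ : riemannZeta ρ = 0) (h0 : 0 < ρ.re) (h1 : ρ.re < 1) :
    mellin (thetaSum G) ρ = 0 := by
  rw [mellin_thetaSum_eq_zeta_mul_of_mem_slit hG hGd hΘd (mem_slitHalfPlane_of_zeta_zero hζ h0 h1), hζ, zero_mul]

end Summit.RiemannHypothesis.RiemannHypothesis.Theorems.WeilColumn.ThetaMellin

namespace Summit.RiemannHypothesis.RiemannHypothesis.Theorems.WeilColumn.ThetaMellin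

/-! ## Discharging the hypotheses for a continuous profile supported in `[c₁, c₂] ⊂ (0, ∞)` -/

/-- A continuous profile vanishing off `[c₁, c₂]` with `0 < c₁` (the PART XIX profile `h(·/λ)` has `c₁ = λ/4`, `c₂ = λ`). -/
structure ProfileHyp (G : ℝ → ℂ) (c₁ c₂ : ℝ) : Prop where
  cont : Continuous G
  pos : 0 < c₁
  le : c₁ ≤ c₂
  zero : ∀ t, t ∉ Icc c₁ c₂ → G t = 0

variable {G : ℝ → ℂ} {c₁ c₂ : ℝ}

/-- A compactly supported profile is eventually zero at `+∞`, hence `O(t^{-a})` for every `a`. [folklore] -/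
theorem ProfileHyp.isBigO_atTop (hG : ProfileHyp G c₁ c₂) (a : ℝ) : G =O[atTop] fun t : ℝ => t ^ (-a) := by
  refine IsBigO.of_bound 0 ?_
  filter_upwards [eventually_gt_atTop c₂] with t ht
  rw [hG.zero t (fun h => not_le.mpr ht h.2), norm_zero, zero_mul]

/-- A profile vanishing on `(0, c₁)` is `O(t^{-b})` at `0⁺` for every `b`. [folklore] -/
theorem ProfileHyp.isBigO_nhdsGT (hG : ProfileHyp G c₁ c₂) (b : ℝ) : G =O[𝓝[>] (0 : ℝ)] fun t : ℝ => t ^ (-b) := by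
  refine IsBigO.of_bound 0 ?_
  filter_upwards [Ioo_mem_nhdsGT hG.pos] with t ht
  rw [hG.zero t (fun h => not_lt.mpr h.1 ht.2), norm_zero, zero_mul]

/-- The Mellin integral of such a profile converges everywhere. -/
theorem ProfileHyp.mellinConvergent (hG : ProfileHyp G c₁ c₂) (z : ℂ) : MellinConvergent G z :=
  mellinConvergent_of_isBigO_rpow (hG.cont.locallyIntegrable.locallyIntegrableOn _) (hG.isBigO_atTop (z.re + 1))
    (by linarith) (hG.isBigO_nhdsGT (z.re - 1)) (by linarith)

/-- … and its Mellin transform is entire. -/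
theorem ProfileHyp.differentiableAt_mellin (hG : ProfileHyp G c₁ c₂) (z : ℂ) : DifferentiableAt ℂ (mellin G) z :=
  mellin_differentiableAt_of_isBigO_rpow (hG.cont.locallyIntegrable.locallyIntegrableOn _) (hG.isBigO_atTop (z.re + 1))
    (by linarith) (hG.isBigO_nhdsGT (z.re - 1)) (by linarith)

/-- Beyond `c₂` every term of the theta series vanishes. -/
theorem ProfileHyp.thetaSum_eq_zero (hG : ProfileHyp G c₁ c₂) {t : ℝ} (ht : c₂ < t) (ht0 : 0 < t) : thetaSum G t = 0 := by
  rw [thetaSum]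
  have h : (fun n : ℕ => G (((n + 1 : ℕ) : ℝ) * t)) = fun _ => 0 := by
    funext n
    apply hG.zero
    intro hmem
    have h1 : (1 : ℝ) ≤ ((n + 1 : ℕ) : ℝ) := by exact_mod_cast Nat.succ_le_succ (Nat.zero_le n)
    have : t ≤ ((n + 1 : ℕ) : ℝ) * t := by nlinarith
    linarith [hmem.2]
  rw [h, tsum_zero]

/-- Near a point `t₀ > 0` the theta series is a FINITE sum: for `t > t₀/2` only the terms with `(n+1) t₀/2 ≤ c₂` can be nonzero. -/
theorem ProfileHyp.thetaSum_eq_sum (hG : ProfileHyp G c₁ c₂) {t₀ : ℝ} (ht₀ : 0 < t₀) {t : ℝ} (ht : t₀ / 2 < t) :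
    thetaSum G t = ∑ n ∈ Finset.range (⌈2 * c₂ / t₀⌉₊ + 1), G (((n + 1 : ℕ) : ℝ) * t) := by
  rw [thetaSum]
  refine tsum_eq_sum fun n hn => hG.zero _ fun hmem => ?_
  rw [Finset.mem_range, not_lt] at hn
  have hn' : (⌈2 * c₂ / t₀⌉₊ : ℝ) + 1 ≤ n := by exact_mod_cast hn
  have hceil : 2 * c₂ / t₀ ≤ (⌈2 * c₂ / t₀⌉₊ : ℝ) := Nat.le_ceil _
  have h2 : 2 * c₂ / t₀ * (t₀ / 2) = c₂ := by field_simp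
  have hnn : (0 : ℝ) ≤ ((n + 1 : ℕ) : ℝ) := by positivity
  have key : c₂ < ((n + 1 : ℕ) : ℝ) * t := by
    have e1 : 2 * c₂ / t₀ + 1 ≤ ((n + 1 : ℕ) : ℝ) := by push_cast; linarith
    by_cases hc : 0 ≤ 2 * c₂ / t₀
    · calc c₂ = 2 * c₂ / t₀ * (t₀ / 2) := h2.symm
        _ < (2 * c₂ / t₀ + 1) * t := by nlinarith
        _ ≤ ((n + 1 : ℕ) : ℝ) * t := by nlinarith
    · have hc' : 2 * c₂ / t₀ < 0 := not_le.mp hc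
      have : c₂ < 0 := by
        rcases div_neg_iff.mp hc' with ⟨h1, _⟩ | ⟨_, h2'⟩
        · linarith
        · linarith
      nlinarith
  linarith [hmem.2]

/-- The theta series of such a profile is continuous on `(0, ∞)`. -/
theorem ProfileHyp.continuousOn_thetaSum (hG : ProfileHyp G c₁ c₂) : ContinuousOn (thetaSum G) (Ioi 0) := by
  intro t₀ ht₀
  have ht₀' : (0 : ℝ) < t₀ := ht₀
  apply ContinuousAt.continuousWithinAt
  have hev : thetaSum G =ᶠ[𝓝 t₀] fun t => ∑ n ∈ Finset.range (⌈2 * c₂ / t₀⌉₊ + 1), G (((n + 1 : ℕ) : ℝ) * t) := by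
    filter_upwards [Ioi_mem_nhds (by linarith : t₀ / 2 < t₀)] with t ht
    exact hG.thetaSum_eq_sum ht₀' ht
  refine (ContinuousAt.congr ?_ hev.symm)
  refine (continuous_finsetSum _ fun n _ => hG.cont.comp (continuous_const.mul continuous_id)).continuousAt

/-- The theta series is locally integrable on `(0, ∞)`. [folklore] -/
theorem ProfileHyp.locallyIntegrableOn_thetaSum (hG : ProfileHyp G c₁ c₂) : LocallyIntegrableOn (thetaSum G) (Ioi 0) :=
  hG.continuousOn_thetaSum.locallyIntegrableOn measurableSet_Ioi

/-- The theta series is eventually zero at `+∞`, hence `O(t^{-a})` for every `a`. [folklore] -/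
theorem ProfileHyp.thetaSum_isBigO_atTop (hG : ProfileHyp G c₁ c₂) (a : ℝ) : thetaSum G =O[atTop] fun t : ℝ => t ^ (-a) := by
  refine IsBigO.of_bound 0 ?_
  filter_upwards [eventually_gt_atTop (max c₂ 0)] with t ht
  rw [hG.thetaSum_eq_zero ((le_max_left _ _).trans_lt ht) ((le_max_right _ _).trans_lt ht), norm_zero, zero_mul]

/-- **Boundedness near `0`** is the one input that uses `∫ G = 0` (Riemann-sum cancellation; discharged separately): here a hypothesis. -/
def ThetaBoundedNearZero (G : ℝ → ℂ) : Prop := ∃ C δ : ℝ, 0 < δ ∧ ∀ t ∈ Ioo 0 δ, ‖thetaSum G t‖ ≤ C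

/-- Bounded near `0` means `O(t^{-0})` at `0⁺`. [folklore] -/
theorem thetaSum_isBigO_nhdsGT_of_bounded (h : ThetaBoundedNearZero G) :
    thetaSum G =O[𝓝[>] (0 : ℝ)] fun t : ℝ => t ^ (-(0 : ℝ)) := by
  obtain ⟨C, δ, hδ, hC⟩ := h
  refine IsBigO.of_bound C ?_
  filter_upwards [Ioo_mem_nhdsGT hδ] with t ht
  rw [neg_zero, Real.rpow_zero, norm_one, mul_one]
  exact hC t ht

/-- The Mellin transform of the theta series is holomorphic on `Re s > 0` once the series is bounded near `0`. -/
theorem ProfileHyp.differentiableAt_mellin_thetaSum (hG : ProfileHyp G c₁ c₂) (hb : ThetaBoundedNearZero G) {z : ℂ}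
    (hz : 0 < z.re) : DifferentiableAt ℂ (mellin (thetaSum G)) z :=
  mellin_differentiableAt_of_isBigO_rpow hG.locallyIntegrableOn_thetaSum (hG.thetaSum_isBigO_atTop (z.re + 1)) (by linarith)
    (thetaSum_isBigO_nhdsGT_of_bounded hb) (by simpa using hz)

/-- **THETA–MELLIN VANISHING for compactly supported profiles (R3 §3′ (Z1), all but the Riemann-sum boundedness).** For a
continuous profile `G` supported in `[c₁, c₂] ⊂ (0, ∞)` whose theta series is bounded near `0` (⇐ `∫ G = 0`, `G ∈ C¹`),
`mellin Θ_G ρ = 0` at every nontrivial zero `ρ` of `ζ`. RH-free. [this seat, R3 §3′ (Z1)] -/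
theorem ProfileHyp.mellin_thetaSum_eq_zero_of_zeta_zero (hG : ProfileHyp G c₁ c₂) (hb : ThetaBoundedNearZero G)
    {ρ : ℂ} (hζ : riemannZeta ρ = 0) (h0 : 0 < ρ.re) (h1 : ρ.re < 1) : mellin (thetaSum G) ρ = 0 :=
  ThetaMellin.mellin_thetaSum_eq_zero_of_zeta_zero (fun z _ => hG.mellinConvergent z)
    (fun z _ => hG.differentiableAt_mellin z) (fun _ hz => hG.differentiableAt_mellin_thetaSum hb hz) hζ h0 h1


/-! ## The `∫ G = 0` input: the theta series is bounded near `0` (Riemann-sum cancellation) -/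

/-- With `a k = (k+1) t`, the theta series at `t ∈ (0, c₁)` is the finite sum over `k < N := ⌈c₂/t⌉₊`. -/
theorem ProfileHyp.thetaSum_eq_sum_ceil (hG : ProfileHyp G c₁ c₂) {t : ℝ} (ht : 0 < t) :
    thetaSum G t = ∑ n ∈ Finset.range ⌈c₂ / t⌉₊, G (((n + 1 : ℕ) : ℝ) * t) := by
  rw [thetaSum]
  refine tsum_eq_sum fun n hn => hG.zero _ fun hmem => ?_
  rw [Finset.mem_range, not_lt] at hn
  have hn' : (⌈c₂ / t⌉₊ : ℝ) ≤ n := by exact_mod_cast hn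
  have hceil : c₂ / t ≤ (⌈c₂ / t⌉₊ : ℝ) := Nat.le_ceil _
  have e1 : c₂ / t + 1 ≤ ((n + 1 : ℕ) : ℝ) := by push_cast; linarith
  have e2 : c₂ < (c₂ / t + 1) * t := by
    have : (c₂ / t + 1) * t = c₂ + t := by field_simp
    linarith
  have e3 : (c₂ / t + 1) * t ≤ ((n + 1 : ℕ) : ℝ) * t := mul_le_mul_of_nonneg_right e1 ht.le
  linarith [hmem.2]

/-- **Bounded near zero from `∫ G = 0`.** If the profile is `L`-Lipschitz and `∫ G = 0`, then for `t ∈ (0, c₁)`: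
`‖Θ_G(t)‖ ≤ L (c₂ + t)`. Proof: `t·Θ(t) − ∫_t^{(N+1)t} G = Σ_{k<N} ∫_{(k+1)t}^{(k+2)t} (G((k+1)t) − G)`, each of norm `≤ L t²`,
and `∫_t^{(N+1)t} G = ∫ G = 0` because `[c₁, c₂] ⊆ (t, (N+1)t]`. -/
theorem ProfileHyp.norm_thetaSum_le (hG : ProfileHyp G c₁ c₂) {L : ℝ} (hL0 : 0 ≤ L)
    (hL : ∀ x y : ℝ, ‖G x - G y‖ ≤ L * |x - y|)
    (hint : ∫ x, G x = 0) {t : ℝ} (ht : 0 < t) (htc : t < c₁) :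
    ‖thetaSum G t‖ ≤ L * (c₂ + t) := by
  set N : ℕ := ⌈c₂ / t⌉₊ with hN
  set a : ℕ → ℝ := fun k => ((k + 1 : ℕ) : ℝ) * t with ha
  -- the integral over (t, (N+1) t] is the whole integral, hence 0
  have hsupp : Function.support G ⊆ Ioc (a 0) (a N) := by
    intro x hx
    rw [Function.mem_support] at hx
    by_contra hx'
    apply hx
    apply hG.zero
    intro hmem
    apply hx'
    refine ⟨?_, ?_⟩
    · show ((0 + 1 : ℕ) : ℝ) * t < x
      push_cast; linarith [hmem.1]
    · show x ≤ ((N + 1 : ℕ) : ℝ) * t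
      have hceil : c₂ / t ≤ (N : ℝ) := Nat.le_ceil _
      have : c₂ ≤ (N : ℝ) * t := by rwa [div_le_iff₀ ht] at hceil
      push_cast; nlinarith [hmem.2]
  have htot : ∫ x in (a 0)..(a N), G x = 0 := by
    rw [intervalIntegral.integral_eq_integral_of_support_subset hsupp, hint]
  have hii : ∀ k < N, IntervalIntegrable G volume (a k) (a (k + 1)) := fun k _ =>
    hG.cont.intervalIntegrable _ _
  have hsum : ∑ k ∈ Finset.range N, ∫ x in (a k)..(a (k + 1)), G x = 0 := by
    rw [intervalIntegral.sum_integral_adjacent_intervals hii, htot]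
  -- each Riemann term is within L t² of its integral
  have hak : ∀ k : ℕ, a (k + 1) - a k = t := by
    intro k; simp only [ha]; push_cast; ring
  have hterm : ∀ k : ℕ, ‖(t : ℂ) * G (a k) - ∫ x in (a k)..(a (k + 1)), G x‖ ≤ L * t ^ 2 := by
    intro k
    have hc : (t : ℂ) * G (a k) = ∫ _ in (a k)..(a (k + 1)), G (a k) := by
      rw [intervalIntegral.integral_const, hak, Complex.real_smul]
    rw [hc, ← intervalIntegral.integral_sub intervalIntegrable_const (hG.cont.intervalIntegrable _ _)]
    have hb : ∀ x ∈ Set.uIoc (a k) (a (k + 1)), ‖G (a k) - G x‖ ≤ L * t := by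
      intro x hx
      have hle : a k ≤ a (k + 1) := by linarith [hak k]
      rw [Set.uIoc_of_le hle] at hx
      calc ‖G (a k) - G x‖ ≤ L * |a k - x| := hL _ _
        _ ≤ L * t := by
          apply mul_le_mul_of_nonneg_left _ hL0
          rw [abs_sub_comm, abs_of_pos (by linarith [hx.1])]
          linarith [hx.2, hak k]
    calc ‖∫ x in (a k)..(a (k + 1)), G (a k) - G x‖ ≤ L * t * |a (k + 1) - a k| :=
          intervalIntegral.norm_integral_le_of_norm_le_const hb
      _ = L * t ^ 2 := by rw [hak, abs_of_pos ht]; ring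
  -- assemble
  have hmain : ‖(t : ℂ) * thetaSum G t‖ ≤ N * (L * t ^ 2) := by
    rw [hG.thetaSum_eq_sum_ceil ht, Finset.mul_sum]
    have : ∑ k ∈ Finset.range N, (t : ℂ) * G (((k + 1 : ℕ) : ℝ) * t) =
        ∑ k ∈ Finset.range N, ((t : ℂ) * G (a k) - ∫ x in (a k)..(a (k + 1)), G x) := by
      rw [Finset.sum_sub_distrib, hsum, sub_zero]
    rw [this]
    calc ‖∑ k ∈ Finset.range N, ((t : ℂ) * G (a k) - ∫ x in (a k)..(a (k + 1)), G x)‖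
        ≤ ∑ k ∈ Finset.range N, ‖(t : ℂ) * G (a k) - ∫ x in (a k)..(a (k + 1)), G x‖ := norm_sum_le _ _
      _ ≤ ∑ _k ∈ Finset.range N, L * t ^ 2 := Finset.sum_le_sum fun k _ => hterm k
      _ = N * (L * t ^ 2) := by rw [Finset.sum_const, Finset.card_range, nsmul_eq_mul]
  have hc₂ : 0 ≤ c₂ := by linarith [hG.pos, hG.le]
  have hNle : (N : ℝ) ≤ c₂ / t + 1 := (Nat.ceil_lt_add_one (by positivity)).le
  have hnorm : ‖(t : ℂ) * thetaSum G t‖ = t * ‖thetaSum G t‖ := by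
    rw [norm_mul, Complex.norm_real, Real.norm_of_nonneg ht.le]
  rw [hnorm] at hmain
  have h3 : t * ‖thetaSum G t‖ ≤ t * (L * (c₂ + t)) := by
    calc t * ‖thetaSum G t‖ ≤ N * (L * t ^ 2) := hmain
      _ ≤ (c₂ / t + 1) * (L * t ^ 2) := by gcongr
      _ = t * (L * (c₂ + t)) := by field_simp
  exact le_of_mul_le_mul_left h3 ht

/-- Hence the theta series of a Lipschitz profile with `∫ G = 0` is bounded near `0`. -/
theorem ProfileHyp.thetaBoundedNearZero (hG : ProfileHyp G c₁ c₂) {L : ℝ} (hL0 : 0 ≤ L)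
    (hL : ∀ x y : ℝ, ‖G x - G y‖ ≤ L * |x - y|) (hint : ∫ x, G x = 0) : ThetaBoundedNearZero G :=
  ⟨L * (c₂ + c₁), c₁, hG.pos, fun t ht => (hG.norm_thetaSum_le hL0 hL hint ht.1 ht.2).trans (by nlinarith [ht.2])⟩

/-- **THETA–MELLIN VANISHING (R3 §3′ (Z1)) — full statement for Lipschitz profiles.** For a Lipschitz profile `G` supported in
`[c₁, c₂] ⊂ (0, ∞)` with `∫ G = 0`, the Mellin transform of `Θ_G = Σ_{n≥1} G(n·)` VANISHES at every nontrivial zero of `ζ`.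
(The PART XIX profile `h(·/λ)` — a two-step function smoothed by a B-spline of order `m ≥ 3` — is `C¹`, hence Lipschitz, with `∫ = 0`.)
RH-free; nothing here bears on the truth of RH. [this seat, R3 §3′ (Z1)] -/
theorem ProfileHyp.mellin_thetaSum_vanishes_at_zeta_zeros (hG : ProfileHyp G c₁ c₂) {L : ℝ} (hL0 : 0 ≤ L)
    (hL : ∀ x y : ℝ, ‖G x - G y‖ ≤ L * |x - y|) (hint : ∫ x, G x = 0)
    {ρ : ℂ} (hζ : riemannZeta ρ = 0) (h0 : 0 < ρ.re) (h1 : ρ.re < 1) : mellin (thetaSum G) ρ = 0 :=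
  hG.mellin_thetaSum_eq_zero_of_zeta_zero (hG.thetaBoundedNearZero hL0 hL hint) hζ h0 h1

end Summit.RiemannHypothesis.RiemannHypothesis.Theorems.WeilColumn.ThetaMellin
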